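import Literature.NumberTheory.DiophantineGeometry.AVIsogenyTateHomPositivityProofs
import Literature.NumberTheory.DiophantineGeometry.AVGaloisModuleContinuityProofs
import HarnessLib

/-!
# `Hom(A, B)` finitely generated (Mumford §19, Theorem 3): Step II without torsion counts, and the
# exact input of the positivity route — the cubical structure of `B` over `K̄`

Tenth proof file for the named fact
`Literature.AlgebraicGeometry.Motives.AbelianVariety.module_finite_hom` of `AVIsogenyTate`
(`Hom(A, B)` is a finitely generated group; Mumford, *Abelian Varieties*, §19, Theorem 3; Milne 1986,
Theorem 12.5), sharpening `AVIsogenyTateHomPositivityProofs`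
(`module_finite_hom_of_theoremOfCube : theoremOfCube_linEquiv → module_finite_hom A B`).

There the Theorem of the Cube (Görtz–Wedhorn II, Thm. 24.73, the named fact `theoremOfCube_linEquiv`,
a statement about all proper geometrically integral `X`, `Y` over all fields) entered three times:
through the cubical structure of `B` (biadditivity of the curve forms), through projectivity of `B`
(a symmetric ample divisor), and — in Step II — through the torsion counts `#A[n](K̄) = n^{2 dim A}`,
`#B[n](K̄) = n^{2 dim B}` (`deg [n] = n^{2g}`), used only to know `T_ℓ ≅ ℤ_ℓ^{2 dim}`. This file
removes the third use and pins the other two to a single named fact about the single abelian variety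
`B_K̄`:

* `rank_hom_le_of_exists_fg` — **Step II of the printed proof needs no torsion count for finite
  generation**: for a prime `ℓ` invertible in `K`, `T_ℓ A` and `T_ℓ B` are finite free `ℤ_ℓ`-modules
  *unconditionally* (`module_finite_tateModule_of_cast_ne_zero`, `module_free_tateModule_holds` of
  `AVGaloisModuleContinuityProofs`: `[ℓ]` is étale, `Lie([ℓ]) = ℓ`, so `A[ℓ](K̄)` is finite, and a
  Tate module with finite `ℓ`-torsion is finite free over the discrete valuation ring `ℤ_ℓ`), so
  Step I alone gives `rank_ℤ Hom(A, B) ≤ rk T_ℓ A · rk T_ℓ B` by the injectivity of the Tate map on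
  saturated finitely generated subgroups (`rank_le_rank_tateHom_of_saturated`, Milne 1986 Lemma 12.6
  being the theorem `exists_eq_pow_smul_of_tateModuleMap_eq`);
* `AbelianVariety.module_finite_hom_of_exists_fg` — **`Hom(A, B)` is finitely generated as soon as
  Step I holds for it** (over the same field; Step III is `module_finite_hom_of_rank_le_of_exists_fg`).
  The rank bound `4 dim A dim B` of Cor. 1 is *not* claimed here — it does need `rk T_ℓ = 2 dim`;
* `exists_fg_of_cubicalStructure_of_isAlgClosed` — Step I over `k = k̄` from the **cubical structure
  of `B` alone** (`B.cubicalStructure_linEquiv`, Görtz–Wedhorn II, Prop. 27.167 for `B`): the proof of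
  `exists_fg_of_theoremOfCube_of_isAlgClosed` verbatim, the symmetric ample divisor now coming from
  `exists_isAmple_symmetric_of_cubicalStructure` (Prop. 27.174 from the theorem of the square for
  `B`, Thm. 27.168, with Lemma 25.150 proved);
* `module_finite_hom_of_cubicalStructure_of_isAlgClosed`,
  **`AbelianVariety.module_finite_hom_of_cubicalStructure`** — for abelian varieties `A`, `B` over any
  field `K`, `Hom(A, B)` is finitely generated granted only the cubical structure on the divisor
  classes of `B_K̄` (`(B.baseChange K̄).cubicalStructure_linEquiv`); nothing about `A`, no torsion
  count, no Poincaré reducibility, no simplicity. In the tree this input is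
  `cubicalStructure_linEquiv_of_theoremOfCube theoremOfCube_linEquiv_holds` once Thm. 24.73 lands
  (itself `theoremOfCube_linEquiv_of_pseudoCoherent_general cechComplex_pseudoCoherent_general_holds`),
  so `module_finite_hom_of_theoremOfCube` (of `AVIsogenyTateHomPositivityProofs`) is recovered.

## References

* [MumfordAV1970] D. Mumford, *Abelian Varieties*, TIFR Studies in Mathematics 5, OUP (1970; 2nd ed.
  1974): §19, Thm. 3 and its proof (pp. 176–178), p. 171 (`T_ℓ`). Not held; architecture as in
  Milne 1986.
* [Milne1986AbelianVarieties] J. S. Milne, *Abelian Varieties*, in Cornell–Silverman (eds.),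
  *Arithmetic Geometry*, Springer (1986): Thm. 12.5 with Lemmas 12.6–12.7 (PDF pp. 190–191) (held:
  `book:cornellnd-arithmetic-geometry`).
* [GortzWedhorn2023] U. Görtz, T. Wedhorn, *Algebraic Geometry II* (2023): Prop. 27.167 (p. 877),
  Thm. 27.168 (p. 878), Prop. 27.174 (p. 880), Thm. 24.73 (p. 550).

## Design

Theorems only: no definition, no named fact, no `_holds` of the target (net debt 0). The cubical
structure enters as the explicit hypothesis `hB : B.cubicalStructure_linEquiv` (an existing named
fact of `Motives/AbelianVarietyCube`, not a restatement of `module_finite_hom`).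
-/

universe u

open CategoryTheory CategoryTheory.Limits AlgebraicGeometry Order

noncomputable section

namespace Literature.NumberTheory.DiophantineGeometry

section AbelianVariety
open Literature.AlgebraicGeometry.Motives (AbelianVariety)
open Literature.AlgebraicGeometry.Motives.AbelianVariety
open scoped MonObj TensorProduct

variable {k : Type u} [Field k] {A B : AbelianVariety k}

/-! ### Step II without torsion counts -/

/-- **Step II of Mumford's proof of §19 Thm. 3 without torsion counts.** If the saturation of every
finitely generated subgroup of `Hom(A, B)` lies in a finitely generated subgroup (Step I) and `ℓ` is a
prime invertible in `k`, then `rank_ℤ Hom(A, B) ≤ rk_{ℤ_ℓ} T_ℓ A · rk_{ℤ_ℓ} T_ℓ B`, where `T_ℓ A`,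
`T_ℓ B` are finite free over `ℤ_ℓ` unconditionally (`module_finite_tateModule_of_cast_ne_zero`,
`module_free_tateModule_holds`: `A[ℓ](k̄)` is finite because `[ℓ]_A` is étale). Proof as in
`rank_hom_le_of_exists_fg_of_tateModule_linearEquiv`: a finite linearly independent `s` lies in the
saturation `S'` of `ℤs`, which is finitely generated (inside the `S` of Step I) and saturated, so
`#s ≤ rank S' ≤ rank Hom_{Γ_k}(T_ℓ A, T_ℓ B) ≤ rank Hom_{ℤ_ℓ}(T_ℓ A, T_ℓ B) = rk T_ℓ A · rk T_ℓ B`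
(`rank_le_rank_tateHom_of_saturated`, Milne 1986 Lemma 12.6/12.7). (Mumford, *Abelian Varieties*,
§19, proof of Thm. 3, second step, with `2g`, `2g'` replaced by the ranks of the Tate modules.)
[cite: MumfordAV1970, §19 Thm. 3 (proof, second step)]
[cite: Milne1986AbelianVarieties, Lemma 12.7 and Thm. 12.5 (PDF pp. 190–191)] -/
theorem rank_hom_le_of_exists_fg (ℓ : ℕ) [Fact ℓ.Prime] (hℓ : (ℓ : k) ≠ 0)
    (hsat : ∀ M : Submodule ℤ (A ⟶ B), M.FG →
      ∃ S : Submodule ℤ (A ⟶ B), S.FG ∧ ∀ f : A ⟶ B, (∃ n : ℤ, n ≠ 0 ∧ n • f ∈ M) → f ∈ S) :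
    Module.rank ℤ (A ⟶ B) ≤
      (Module.finrank ℤ_[ℓ] (A.tateModule ℓ) * Module.finrank ℤ_[ℓ] (B.tateModule ℓ) : ℕ) := by
  haveI : Module.Free ℤ_[ℓ] (A.tateModule ℓ) := module_free_tateModule_holds A ℓ hℓ
  haveI : Module.Finite ℤ_[ℓ] (A.tateModule ℓ) := module_finite_tateModule_of_cast_ne_zero A ℓ hℓ
  haveI : Module.Free ℤ_[ℓ] (B.tateModule ℓ) := module_free_tateModule_holds B ℓ hℓ
  haveI : Module.Finite ℤ_[ℓ] (B.tateModule ℓ) := module_finite_tateModule_of_cast_ne_zero B ℓ hℓ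
  -- the bound for saturated finitely generated subgroups
  have hbound : ∀ S : Submodule ℤ (A ⟶ B), S.FG →
      (∀ (n : ℤ) (f : A ⟶ B), n ≠ 0 → n • f ∈ S → f ∈ S) →
      Module.rank ℤ S ≤
        (Module.finrank ℤ_[ℓ] (A.tateModule ℓ) * Module.finrank ℤ_[ℓ] (B.tateModule ℓ) : ℕ) :=
    fun S hS hSsat =>
    calc Module.rank ℤ S
        ≤ Module.rank ℤ_[ℓ] (tateHom A B ℓ) := rank_le_rank_tateHom_of_saturated ℓ hℓ S hS hSsat
      _ ≤ Module.rank ℤ_[ℓ] (A.tateModule ℓ →ₗ[ℤ_[ℓ]] B.tateModule ℓ) := rank_tateHom_le A B ℓ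
      _ = (Module.finrank ℤ_[ℓ] (A.tateModule ℓ) * Module.finrank ℤ_[ℓ] (B.tateModule ℓ) : ℕ) :=
          rank_linearMap_tateModule A B ℓ
  apply rank_le
  intro s hs
  -- `M = ℤs` and its saturation `S'`
  set M : Submodule ℤ (A ⟶ B) := Submodule.span ℤ (s : Set (A ⟶ B)) with hM_def
  let S' : Submodule ℤ (A ⟶ B) :=
    { carrier := {f | ∃ n : ℤ, n ≠ 0 ∧ n • f ∈ M}
      add_mem' := by
        rintro f g ⟨n, hn, hf⟩ ⟨m, hm, hg⟩
        refine ⟨m * n, mul_ne_zero hm hn, ?_⟩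
        rw [smul_add]
        refine M.add_mem ?_ ?_
        · rw [mul_smul]; exact M.smul_mem m hf
        · rw [mul_comm, mul_smul]; exact M.smul_mem n hg
      zero_mem' := ⟨1, one_ne_zero, by rw [smul_zero]; exact M.zero_mem⟩
      smul_mem' := by
        rintro c f ⟨n, hn, hf⟩
        exact ⟨n, hn, by rw [smul_comm]; exact M.smul_mem c hf⟩ }
  have hS'mem : ∀ f : A ⟶ B, f ∈ S' ↔ ∃ n : ℤ, n ≠ 0 ∧ n • f ∈ M := fun f => Iff.rfl
  have hS'sat : ∀ (c : ℤ) (f : A ⟶ B), c ≠ 0 → c • f ∈ S' → f ∈ S' := by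
    rintro c f hc ⟨n, hn, hf⟩
    exact ⟨n * c, mul_ne_zero hn hc, by rwa [mul_smul]⟩
  -- `S'` is finitely generated: it lies in the finitely generated `S` given by Step I
  obtain ⟨S, hSfg, hS⟩ := hsat M (Submodule.fg_span s.finite_toSet)
  have hle : S' ≤ S := fun f hf => hS f ((hS'mem f).1 hf)
  have hS'fg : S'.FG := by
    haveI : Module.Finite ℤ S := Module.Finite.iff_fg.2 hSfg
    have h := (IsNoetherian.noetherian (R := ℤ) (M := S) (S'.comap S.subtype)).map S.subtype
    rwa [Submodule.map_comap_subtype, inf_eq_right.2 hle] at h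
  -- `s ⊆ S'` is linearly independent in `S'`
  have hsub : ∀ f : A ⟶ B, f ∈ s → f ∈ S' := fun f hf =>
    ⟨1, one_ne_zero, by rw [one_smul]; exact Submodule.subset_span hf⟩
  have hs' : LinearIndependent ℤ fun i : s => (⟨(i : A ⟶ B), hsub i i.2⟩ : S') :=
    LinearIndependent.of_comp S'.subtype hs
  have hcard := hs'.cardinal_le_rank.trans (hbound S' hS'fg hS'sat)
  rw [Cardinal.mk_coe_finset] at hcard
  exact_mod_cast hcard

variable (A B) in
/-- **Mumford §19 Thm. 3 (finite generation of `Hom(A, B)`) from Step I alone.** If the saturation of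
every finitely generated subgroup of `Hom(A, B)` lies in a finitely generated subgroup, then
`Hom(A, B)` is finitely generated: pick a prime `ℓ ≠ char k` (`exists_prime_natCast_ne_zero`), bound
the rank by `rank_hom_le_of_exists_fg` (Step II, the Tate modules being finite free over `ℤ_ℓ`
unconditionally), and conclude by Step III (`module_finite_hom_of_rank_le_of_exists_fg`). In
particular the torsion counts `#A[n](k̄) = n^{2 dim A}` (theorem of the cube) are not needed for
Theorem 3 itself — only for the rank bound `4 dim A dim B` of its Corollary 1.
[cite: MumfordAV1970, §19 Thm. 3 (proof)] [cite: Milne1986AbelianVarieties, Thm. 12.5 (PDF p. 190)] -/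
theorem _root_.Literature.AlgebraicGeometry.Motives.AbelianVariety.module_finite_hom_of_exists_fg
    (hsat : ∀ M : Submodule ℤ (A ⟶ B), M.FG →
      ∃ S : Submodule ℤ (A ⟶ B), S.FG ∧ ∀ f : A ⟶ B, (∃ n : ℤ, n ≠ 0 ∧ n • f ∈ M) → f ∈ S) :
    module_finite_hom A B := by
  obtain ⟨ℓ, hℓp, hℓ⟩ := exists_prime_natCast_ne_zero k
  haveI : Fact ℓ.Prime := ⟨hℓp⟩
  exact module_finite_hom_of_rank_le_of_exists_fg A B _ (rank_hom_le_of_exists_fg ℓ hℓ hsat) hsat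

/-! ### Step I over `k̄` from the cubical structure of `B` alone -/

/-- **Step I over `k = k̄` from the cubical structure of the target.** Granted the cubical structure
on the divisor classes of `B` (`B.cubicalStructure_linEquiv`, Görtz–Wedhorn II, Prop. 27.167 for
`B`), the saturation of every finitely generated subgroup of `Hom(A, B)` lies in a finitely generated
subgroup. This is `exists_fg_of_theoremOfCube_of_isAlgClosed` with its two uses of the Theorem of the
Cube traced to `B`: the symmetric ample divisor `D` on `B` comes from
`exists_isAmple_symmetric_of_cubicalStructure` (Prop. 27.174 via the theorem of the square for `B`,
Thm. 27.168, and Lemma 25.150, proved), and the biadditivity of the curve forms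
`N_{c,L}(f) = deg_C ((f ∘ c)^* L)`, `L = d • D`, is the cubical structure of `B` on `C`-points
(`Motives/AbelianVarietyHomCurveForm`); positivity (`N ≥ 0`, and `N(f) ≥ 1` on a test curve where
`f ≠ 0` is not constant, `exists_testCurve_apply_ne`) and the discreteness lemma
(`exists_fg_of_isPositiveForm`) are unconditional. [cite: MumfordAV1970, §19 Thm. 3 (proof, first step)]
[cite: GortzWedhorn2023, Prop. 27.167 (p. 877) and Prop. 27.174 (p. 880)] -/
theorem exists_fg_of_cubicalStructure_of_isAlgClosed [IsAlgClosed k]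
    (hB : B.cubicalStructure_linEquiv) (M : Submodule ℤ (A ⟶ B)) (hM : M.FG) :
    ∃ S : Submodule ℤ (A ⟶ B), S.FG ∧ ∀ φ : A ⟶ B, (∃ n : ℤ, n ≠ 0 ∧ n • φ ∈ M) → φ ∈ S := by
  -- a symmetric divisor on `B` generated by affine sections
  obtain ⟨D, hDamp, hDsym⟩ := B.exists_isAmple_symmetric_of_cubicalStructure hB
  obtain ⟨d, -, hgen⟩ := hDamp.exists_forall_mem_nonvanishing
  have hsym : ((d • D).pullback (Hom.toSchemeHom (-𝟙 B))).LinEquiv (d • D) := by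
    rw [Literature.AlgebraicGeometry.Motives.CartierDivisor.pullback_smul]; exact hDsym.smul d
  have hgen' : ∀ b : ↥B.X.left, ∃ s : B.X.left.functionField,
      (d • D).IsSection s ∧ b ∈ (d • D).nonvanishing s := fun b => by
    obtain ⟨s, h1, h2, -⟩ := hgen b; exact ⟨s, h1, h2⟩
  -- the family of curve forms, indexed by the test curves in `A`
  have hNB : ∀ t : TestCurve A, IsPositiveForm (curveForm (d • D) t.C t.c)
      (curvePairing (d • D) t.c t.height_top hB) := fun t =>
    { two_mul_eq := fun f => two_mul_curveForm (d • D) t.c t.height_top hB hsym f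
      symm := fun f g => curvePairing_comm (d • D) t.c t.height_top hB f g
      nonneg := fun f => curveForm_nonneg (d • D) t.c t.height_top hgen' f }
  have hsep : ∀ f : A ⟶ B, f ≠ 0 → ∃ t : TestCurve A, 1 ≤ curveForm (d • D) t.C t.c f :=
    fun f hf => by
      obtain ⟨t, w, hw⟩ := exists_testCurve_apply_ne hf
      exact ⟨t, one_le_curveForm (d • D) t.c t.height_top hgen f hw⟩
  exact exists_fg_of_isPositiveForm hNB hsep M hM

/-- **`Hom(A, B)` is finitely generated over an algebraically closed field, from the cubical
structure of `B` alone** (Mumford §19 Thm. 3): Step I is `exists_fg_of_cubicalStructure_of_isAlgClosed`,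
Steps II–III are `module_finite_hom_of_exists_fg` (no torsion counts).
[cite: MumfordAV1970, §19 Thm. 3 (pp. 176–178)] -/
theorem module_finite_hom_of_cubicalStructure_of_isAlgClosed [IsAlgClosed k]
    (hB : B.cubicalStructure_linEquiv) : module_finite_hom A B :=
  module_finite_hom_of_exists_fg A B (exists_fg_of_cubicalStructure_of_isAlgClosed hB)

variable (A B) in
/-- **Mumford §19, Theorem 3 over an arbitrary field from the cubical structure of `B_K̄` alone.**
For abelian varieties `A`, `B` over any field `k`, `Hom_k(A, B)` is a finitely generated group
granted only Görtz–Wedhorn II, Prop. 27.167 for the single abelian variety `B_k̄`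
(`(B.baseChange k̄).cubicalStructure_linEquiv`): `Hom_k(A, B) ↪ Hom_k̄(A_k̄, B_k̄)`
(`module_finite_hom_of_baseChange`; Milne 1986, Thm. 12.5) and
`module_finite_hom_of_cubicalStructure_of_isAlgClosed`. No hypothesis on `A`, no torsion count, no
Poincaré reducibility and no simplicity enter; the positivity used is that of Mumford §21 Thm. 1 /
Milne 1986 Thm. 17.3, localised to curves. [cite: MumfordAV1970, §19 Thm. 3 (pp. 176–178)]
[cite: Milne1986AbelianVarieties, Thm. 12.5 (PDF p. 190)]
[cite: GortzWedhorn2023, Prop. 27.167 (p. 877)] -/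
theorem _root_.Literature.AlgebraicGeometry.Motives.AbelianVariety.module_finite_hom_of_cubicalStructure
    (hB : (B.baseChange (AlgebraicClosure k)).cubicalStructure_linEquiv) : module_finite_hom A B :=
  module_finite_hom_of_baseChange (A := A) (B := B) (AlgebraicClosure k)
    (module_finite_hom_of_cubicalStructure_of_isAlgClosed hB)

end AbelianVariety

end Literature.NumberTheory.DiophantineGeometry
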